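import Mathlib.Analysis.Asymptotics.Lemmas
import Mathlib.Analysis.SpecialFunctions.Pow.Continuity
import Mathlib.Analysis.SpecialFunctions.Pow.Real
import Mathlib.Analysis.SpecialFunctions.Log.Base
import Mathlib.Analysis.SpecificLimits.Basic
import Literature.Computability.AlgebraicComplexity.CohnUmansTPP
import Literature.Computability.AlgebraicComplexity.TensorRankFactsProofs
import Literature.Computability.AlgebraicComplexity.TensorRestrictionRank
import Literature.Computability.AlgebraicComplexity.GroupAlgebraTensor
import Literature.RepresentationTheory.FiniteGroups.WedderburnBlocks
import HarnessLib

/-!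
# Proof of the Cohn–Umans inequality (CKSU 2005, Thm. 1.8 and Cor. 1.9)

Topic `Literature/Computability/AlgebraicComplexity`; sibling of `CohnUmansTPP.lean`, whose named
facts `CKSU2005_thm18` ("Suppose `G` realizes `⟨n, m, p⟩` and the character degrees of `G` are
`{dᵢ}`. Then `(nmp)^{ω/3} ≤ ∑ᵢ dᵢ^ω`", CKSU 2005, Thm. 1.8 = Cohn–Umans 2003, Thm. 4.1) and
`CKSU2005_cor19` ("Suppose `G` realizes `⟨n, m, p⟩` and has largest character degree `d`. Then
`(nmp)^{ω/3} ≤ d^{ω-2} |G|`", CKSU 2005, Cor. 1.9, p. 4) are DISCHARGED here: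
`CKSU2005_thm18_holds : CKSU2005_thm18`, `CKSU2005_cor19_holds : CKSU2005_cor19`.

The proof is the printed one (Cohn–Umans 2003, proof of Thm. 4.1, p. 6, of which CKSU Thm. 1.8 /
Cor. 1.9 are restatements), organised around an arbitrary Wedderburn decomposition
`φ : ℂ[G] ≃ₐ ∏_{i<r} ℂ^{dᵢ×dᵢ}` (`WedderburnBlocks.lean`) instead of the character table:

1. `⟨n,m,p⟩ ≤ ℂ[G] ≃ ⊕ᵢ ⟨dᵢ,dᵢ,dᵢ⟩` and its `N`-th tensor power, in rank form:
   `R(⟨n^N, m^N, p^N⟩) ≤ ∑_{J : Fin N → Fin r} R(⟨∏ₗ d_{J l}, …⟩)`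
   (`tensorRank_matMulTensor_pow_le_of_algEquiv`, `GroupAlgebraTensor.lean`);
2. "two facts about the rank of matrix multiplication": `(n'm'p')^{ω/3} ≤ R(⟨n',m',p'⟩)`
   (BCS Prop. 15.5 = Bläser 2013, Thm. 5.9, the tree's `Blaser2013Thm59_holds`;
   here `rpow_omega_div_three_le_tensorRank`) and `∀ ε > 0 ∃ C ∀ k ≥ 1, R(⟨k,k,k⟩) ≤ C k^{ω+ε}`
   (BCS Prop. 15.1 / p. 425, from the definition of `ω` as an infimum; the tree's
   `exists_tensorRank_matMulTensor_le_rpow`, `TensorRestrictionRank.lean`);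
3. hence `(nmp)^{Nω/3} ≤ C (∑ᵢ dᵢ^{ω+ε})^N` for all `N`; "take the `N`-th root and let `N` go to
   infinity" (`le_of_pow_le_mul_pow`), then `ε → 0` "by continuity" (`le_of_forall_pos_le_sum_rpow`):
   `(nmp)^{ω/3} ≤ ∑ᵢ dᵢ^ω` — **Thm. 1.8 in Wedderburn-block form**,
   `rpow_omega_le_sum_blockDegrees_rpow`;
4. Cor. 1.9: `∑ᵢ dᵢ^ω ≤ d_max^{ω-2} ∑ᵢ dᵢ² = d_max^{ω-2} |G|`, using `∑ dᵢ² = |G|`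
   (`sum_sq_blockDegrees_eq_card`), `dᵢ ≤ d_max(G)` (`blockDegree_le_maxCharDegree`: each block is
   an irreducible representation) and `ω ≥ 2` (`omega_two_le`);
5. Thm. 1.8 as vendored (`charDegreePowSum G ω = ∑_χ χ(1)^ω` over ALL irreducible characters):
   the block characters are pairwise distinct irreducible characters of degrees `dᵢ`, and there are
   finitely many irreducible characters (orthogonality), so `∑ᵢ dᵢ^ω ≤ ∑_χ χ(1)^ω`
   (`sum_blockDegrees_rpow_le_charDegreePowSum`, `WedderburnBlocks.lean`).

## References

* H. Cohn, R. Kleinberg, B. Szegedy, C. Umans, *Group-theoretic algorithms for matrix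
  multiplication*, FOCS 2005, 379–388, arXiv:math/0511460: Thm. 1.8, Cor. 1.9 (p. 4).
  [CohnKleinbergSzegedyUmans2005]
* H. Cohn, C. Umans, *A group-theoretic approach to fast matrix multiplication*, FOCS 2003,
  438–449, arXiv:math/0307321: Thm. 2.3 (p. 5), Thm. 4.1 and its proof (p. 6). [CohnUmans2003]
* P. Bürgisser, M. Clausen, M. A. Shokrollahi, *Algebraic Complexity Theory*, Springer 1997,
  Prop. 15.1, Prop. 15.5. [BurgisserClausenShokrollahi1997]
* M. Bläser, *Fast Matrix Multiplication*, Theory of Computing Graduate Surveys 5 (2013),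
  Thm. 5.9. [Blaser2013]
-/

noncomputable section

open scoped BigOperators
open Filter Asymptotics Topology

namespace Literature.Computability.AlgebraicComplexity

/-! ## Two facts about the rank of matrix multiplication -/

section RankFacts

variable (K : Type) [Field K]

/-- **`(nmp)^{ω/3} ≤ R(⟨n, m, p⟩)`** for `nmp ≥ 1` (Bürgisser–Clausen–Shokrollahi 1997,
Prop. 15.5; Cohn–Umans 2003, proof of Thm. 4.1). For `nmp ≥ 2` this is Bläser 2013, Thm. 5.9
("if `R(⟨k,m,n⟩) ≤ r` then `ω ≤ 3 log_{kmn} r`", the tree's `Blaser2013Thm59_holds`) read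
backwards; for `nmp = 1`, `R(⟨1,1,1⟩) ≥ 1`. [cite: BurgisserClausenShokrollahi1997, Prop. 15.5] -/
theorem rpow_omega_div_three_le_tensorRank {n m p : ℕ} (h : 1 ≤ n * m * p) :
    ((n * m * p : ℕ) : ℝ) ^ (omega K / 3) ≤ tensorRank (matMulTensor K n m p) := by
  have hm : m ≠ 0 := fun hm => by simp [hm] at h
  haveI : NeZero m := ⟨hm⟩
  -- `R ≥ np ≥ 1`
  have hR1 : 1 ≤ tensorRank (matMulTensor K n m p) := by
    refine le_trans ?_ (mul_le_tensorRank_matMulTensor K n m p)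
    exact Nat.one_le_iff_ne_zero.2 fun h0 => by
      rcases mul_eq_zero.1 h0 with hn | hp
      · simp [hn] at h
      · simp [hp] at h
  rcases h.eq_or_lt with h1 | h2
  · rw [← h1]
    simp only [Nat.cast_one, Real.one_rpow]
    exact_mod_cast hR1
  · set r := tensorRank (matMulTensor K n m p) with hr
    have hω : omega K ≤ 3 * Real.logb (n * m * p : ℕ) r := Blaser2013Thm59_holds K n m p r h2 le_rfl
    have hq : (1 : ℝ) < (n * m * p : ℕ) := by exact_mod_cast h2
    have hq0 : (0 : ℝ) < (n * m * p : ℕ) := zero_lt_one.trans hq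
    have hr0 : (0 : ℝ) < r := by exact_mod_cast hR1
    have hlog : 0 < Real.log (n * m * p : ℕ) := Real.log_pos hq
    rw [Real.logb] at hω
    have h3 : omega K / 3 * Real.log (n * m * p : ℕ) ≤ Real.log r :=
      (le_div_iff₀ hlog).1 ((div_le_iff₀' (by norm_num : (0 : ℝ) < 3)).2 hω)
    calc ((n * m * p : ℕ) : ℝ) ^ (omega K / 3)
        = Real.exp (Real.log (n * m * p : ℕ) * (omega K / 3)) := Real.rpow_def_of_pos hq0 _
      _ ≤ Real.exp (Real.log r) := Real.exp_le_exp.2 (by rw [mul_comm]; exact h3)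
      _ = r := Real.exp_log hr0

end RankFacts

/-! ## Two limit arguments -/

/-- "Take the `N`-th root and let `N` go to infinity": if `a^N ≤ C b^N` for all `N` (`b > 0`)
then `a ≤ b`. [cite: CohnUmans2003, Thm. 4.1 (proof)] -/
theorem le_of_pow_le_mul_pow {a b C : ℝ} (hb : 0 < b) (h : ∀ N : ℕ, a ^ N ≤ C * b ^ N) :
    a ≤ b := by
  by_contra hab
  rw [not_le] at hab
  have h1 : 1 < a / b := (one_lt_div hb).2 hab
  have hle : ∀ N : ℕ, (a / b) ^ N ≤ C := fun N => by
    rw [div_pow, div_le_iff₀ (pow_pos hb N)]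
    exact h N
  have hlim := tendsto_pow_atTop_atTop_of_one_lt h1
  obtain ⟨N, hN⟩ := (hlim.eventually_gt_atTop C).exists
  exact absurd (hle N) (not_le.2 hN)

/-- "Because this inequality holds for all `ε > 0`, it must hold for `ε = 0` as well, by
continuity": if `a ≤ ∑ᵢ dᵢ^{s+ε}` for all `ε > 0` (`dᵢ > 0`) then `a ≤ ∑ᵢ dᵢ^s`.
[cite: CohnUmans2003, Thm. 4.1 (proof)] -/
theorem le_of_forall_pos_le_sum_rpow {r : ℕ} {d : Fin r → ℝ} (hd : ∀ i, 0 < d i) {a s : ℝ}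
    (h : ∀ ε : ℝ, 0 < ε → a ≤ ∑ i, d i ^ (s + ε)) : a ≤ ∑ i, d i ^ s := by
  have hlim : Tendsto (fun ε : ℝ => ∑ i, d i ^ (s + ε)) (𝓝[>] (0 : ℝ))
      (𝓝 (∑ i, d i ^ s)) := by
    refine tendsto_finsetSum _ fun i _ => ?_
    have hc : ContinuousAt (fun x : ℝ => d i ^ x) s := Real.continuousAt_const_rpow (hd i).ne'
    have hadd : Tendsto (fun ε : ℝ => s + ε) (𝓝[>] (0 : ℝ)) (𝓝 s) := by
      have : Tendsto (fun ε : ℝ => s + ε) (𝓝 (0 : ℝ)) (𝓝 (s + 0)) :=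
        tendsto_const_nhds.add tendsto_id
      rw [add_zero] at this
      exact this.mono_left nhdsWithin_le_nhds
    exact hc.tendsto.comp hadd
  exact ge_of_tendsto hlim (eventually_nhdsWithin_of_forall fun ε hε => h ε hε)

/-! ## Thm. 1.8 in Wedderburn-block form -/

open Literature.RepresentationTheory.FiniteGroups

/-- **Cohn–Umans 2003, Thm. 4.1 / CKSU 2005, Thm. 1.8, in Wedderburn-block form.** If a finite
group `G` realizes `⟨n, m, p⟩` and `ℂ[G] ≃ₐ ∏_{i<r} ℂ^{dᵢ×dᵢ}` (`dᵢ ≥ 1`), then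
`(nmp)^{ω/3} ≤ ∑ᵢ dᵢ^ω`. Proof as printed (Cohn–Umans 2003, p. 6): rank of the `N`-th tensor power
of `⟨n,m,p⟩ ≤ ℂ[G] ≃ ⊕ᵢ ⟨dᵢ,dᵢ,dᵢ⟩` gives `(nmp)^{Nω/3} ≤ C (∑ᵢ dᵢ^{ω+ε})^N`; `N → ∞`, then
`ε → 0`. [cite: CohnKleinbergSzegedyUmans2005, Thm. 1.8] -/
theorem rpow_omega_le_sum_blockDegrees_rpow {G : Type} [Group G] [Finite G] {n m p : ℕ}
    (h : RealizesTPP G n m p) {r : ℕ} {d : Fin r → ℕ} [∀ i, NeZero (d i)]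
    (φ : MonoidAlgebra ℂ G ≃ₐ[ℂ] BlockAlgebraC d) :
    ((n * m * p : ℕ) : ℝ) ^ (omega ℂ / 3) ≤ ∑ i, (d i : ℝ) ^ omega ℂ := by
  classical
  haveI : Fintype G := Fintype.ofFinite G
  have hω0 : 0 < omega ℂ := zero_lt_two.trans_le (omega_two_le (K := ℂ))
  have hd : ∀ i, (0 : ℝ) < d i := fun i => by exact_mod_cast Nat.pos_of_ne_zero (NeZero.ne _)
  rcases Nat.eq_zero_or_pos (n * m * p) with hq | hq
  · -- `nmp = 0`
    rw [hq, Nat.cast_zero, Real.zero_rpow (div_pos hω0 three_pos).ne']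
    exact Finset.sum_nonneg fun i _ => Real.rpow_nonneg (Nat.cast_nonneg _) _
  -- `nmp ≥ 1`: the tensor-power argument, for every `ε > 0`
  refine le_of_forall_pos_le_sum_rpow hd fun ε hε => ?_
  obtain ⟨C, -, hCk⟩ := exists_tensorRank_matMulTensor_le_rpow ℂ hε
  have hb : 0 < ∑ i, (d i : ℝ) ^ (omega ℂ + ε) := by
    have hcard : ∑ i, d i ^ 2 = Nat.card G := sum_sq_blockDegrees_eq_card φ
    have hr : (Finset.univ : Finset (Fin r)).Nonempty := by
      rw [Finset.univ_nonempty_iff]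
      by_contra hr
      rw [not_nonempty_iff] at hr
      rw [Finset.univ_eq_empty, Finset.sum_empty] at hcard
      exact Nat.card_pos.ne' hcard.symm
    exact Finset.sum_pos (fun i _ => Real.rpow_pos_of_pos (hd i) _) hr
  refine le_of_pow_le_mul_pow (C := C) hb fun N => ?_
  have hDJ : ∀ J : Fin N → Fin r, 1 ≤ ∏ l, d (J l) := fun J =>
    Finset.prod_pos fun l _ => Nat.pos_of_ne_zero (NeZero.ne _)
  -- `(nmp)^{Nω/3} ≤ R(⟨n^N, m^N, p^N⟩)`
  have hqN : 1 ≤ n ^ N * m ^ N * p ^ N := by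
    rw [← mul_pow, ← mul_pow]; exact Nat.one_le_pow _ _ hq
  have hx : (0 : ℝ) ≤ ((n * m * p : ℕ) : ℝ) := Nat.cast_nonneg _
  have hcast : ((n ^ N * m ^ N * p ^ N : ℕ) : ℝ) = ((n * m * p : ℕ) : ℝ) ^ N := by
    push_cast
    ring
  have hpow : (((n * m * p : ℕ) : ℝ) ^ N) ^ (omega ℂ / 3) =
      (((n * m * p : ℕ) : ℝ) ^ (omega ℂ / 3)) ^ N := by
    rw [← Real.rpow_natCast ((n * m * p : ℕ) : ℝ) N,
      ← Real.rpow_natCast (((n * m * p : ℕ) : ℝ) ^ (omega ℂ / 3)) N, ← Real.rpow_mul hx,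
      ← Real.rpow_mul hx, mul_comm (N : ℝ)]
  have step1 : (((n * m * p : ℕ) : ℝ) ^ (omega ℂ / 3)) ^ N ≤
      tensorRank (matMulTensor ℂ (n ^ N) (m ^ N) (p ^ N)) := by
    have := rpow_omega_div_three_le_tensorRank ℂ hqN
    rwa [hcast, hpow] at this
  -- `R(⟨n^N, m^N, p^N⟩) ≤ ∑_J R(⟨∏ d_{J l}, …⟩)`
  have step2 : (tensorRank (matMulTensor ℂ (n ^ N) (m ^ N) (p ^ N)) : ℝ) ≤
      ∑ J : Fin N → Fin r, (tensorRank (matMulTensor ℂ (∏ l, d (J l)) (∏ l, d (J l))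
        (∏ l, d (J l))) : ℝ) := by
    exact_mod_cast tensorRank_matMulTensor_pow_le_of_algEquiv ℂ d h φ N
  -- `R(⟨D_J, D_J, D_J⟩) ≤ C D_J^{ω+ε} = C ∏ₗ d_{J l}^{ω+ε}`
  have step3 : ∀ J : Fin N → Fin r,
      (tensorRank (matMulTensor ℂ (∏ l, d (J l)) (∏ l, d (J l)) (∏ l, d (J l))) : ℝ) ≤
        C * ∏ l, (d (J l) : ℝ) ^ (omega ℂ + ε) := fun J => by
    refine (hCk _ (hDJ J)).trans_eq ?_
    rw [Nat.cast_prod, Real.finsetProd_rpow _ _ fun l _ => (hd (J l)).le]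
  calc (((n * m * p : ℕ) : ℝ) ^ (omega ℂ / 3)) ^ N
      ≤ ∑ J : Fin N → Fin r, C * ∏ l, (d (J l) : ℝ) ^ (omega ℂ + ε) :=
        step1.trans (step2.trans (Finset.sum_le_sum fun J _ => step3 J))
    _ = C * (∑ i, (d i : ℝ) ^ (omega ℂ + ε)) ^ N := by
        rw [← Finset.mul_sum, Fintype.sum_pow]

/-- DISCHARGE of the named fact `CKSU2005_thm18` (`CohnUmansTPP.lean`) — **Cohn–Umans 2003,
Thm. 4.1 = Cohn–Kleinberg–Szegedy–Umans 2005, Thm. 1.8**: "Suppose `G` realizes `⟨n, m, p⟩` and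
the character degrees of `G` are `{dᵢ}`. Then `(nmp)^{ω/3} ≤ ∑ᵢ dᵢ^ω`" (the sum over all
irreducible characters `χ` of `χ(1)^ω`, `charDegreePowSum G ω`). From the block form and
`∑_{blocks} dᵢ^ω ≤ ∑_χ χ(1)^ω`. [cite: CohnKleinbergSzegedyUmans2005, Thm. 1.8] -/
theorem CKSU2005_thm18_holds : CKSU2005_thm18 := by
  intro G _ _ n m p h
  obtain ⟨r, d, hd, ⟨φ⟩⟩ := exists_algEquiv_pi_matrix G
  haveI := hd
  exact (rpow_omega_le_sum_blockDegrees_rpow h φ).trans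
    (sum_blockDegrees_rpow_le_charDegreePowSum φ _)

/-! ## Cor. 1.9 -/

/-- DISCHARGE of the named fact `CKSU2005_cor19` (`CohnUmansTPP.lean`) — **Cohn–Kleinberg–Szegedy–
Umans 2005, Cor. 1.9**: "Suppose `G` realizes `⟨n, m, p⟩` and has largest character degree `d`.
Then `(nmp)^{ω/3} ≤ d^{ω-2} |G|`." From Thm. 1.8 in block form and `∑ᵢ dᵢ² = |G|`: every block
size is a character degree, so `dᵢ ≤ d_max(G)` and `∑ᵢ dᵢ^ω = ∑ᵢ dᵢ^{ω-2} dᵢ² ≤ d_max^{ω-2} |G|`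
(`ω ≥ 2`). [cite: CohnKleinbergSzegedyUmans2005, Cor. 1.9] -/
theorem CKSU2005_cor19_holds : CKSU2005_cor19 := by
  intro G _ _ n m p h
  obtain ⟨r, d, hd, ⟨φ⟩⟩ := exists_algEquiv_pi_matrix G
  haveI := hd
  have hω2 : 0 ≤ omega ℂ - 2 := sub_nonneg.2 (omega_two_le (K := ℂ))
  have hdpos : ∀ i, (0 : ℝ) < d i := fun i => by exact_mod_cast Nat.pos_of_ne_zero (NeZero.ne _)
  refine (rpow_omega_le_sum_blockDegrees_rpow h φ).trans ?_
  have hcard : ((Nat.card G : ℕ) : ℝ) = ∑ i, (d i : ℝ) ^ 2 := by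
    rw [← sum_sq_blockDegrees_eq_card φ]; push_cast; rfl
  rw [hcard, Finset.mul_sum]
  refine Finset.sum_le_sum fun i _ => ?_
  have hle : (d i : ℝ) ≤ maxCharDegree G := by exact_mod_cast blockDegree_le_maxCharDegree φ i
  calc (d i : ℝ) ^ omega ℂ = (d i : ℝ) ^ (omega ℂ - 2 + 2) := by rw [sub_add_cancel]
    _ = (d i : ℝ) ^ (omega ℂ - 2) * (d i : ℝ) ^ 2 := by
      rw [Real.rpow_add (hdpos i), Real.rpow_two]
    _ ≤ (maxCharDegree G : ℝ) ^ (omega ℂ - 2) * (d i : ℝ) ^ 2 :=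
      mul_le_mul_of_nonneg_right (Real.rpow_le_rpow (hdpos i).le hle hω2) (sq_nonneg _)

end Literature.Computability.AlgebraicComplexity

end
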